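import Summits.ValiantsHypothesis.ValiantsHypothesis.Theorems.DepthWindowDualityHalving
import Summits.ValiantsHypothesis.ValiantsHypothesis.Theorems.DepthWindowBDSSlope
import HarnessLib

/-!
# Route `DepthWindow`, g11 — the inhomogeneous A-cell: `ImmHardAt 1 1 → PerHardLog3`, and the hard
column at every slope `≤ 36/25`

Companion of `DepthWindowDualityHalving.lean` (workshop `decomp-valiant`, lens 4, generation 11).
Two kernel facts, 0 sorry, no new definitions:

* `perHardLog3_of_immHardAt_one_one` — the `IMM` version of the crux (`ImmHardAt 1 1`: circuits of
  product-depth `≤ L₃ m + c` for `IMM_{m,⌊√log₂ m⌋}` over `ℂ` have more than `m^c + c` gates, NO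
  homogeneity) implies `PerHardLog3`, by projection transport alone (`IMM` is a p-projection of the
  permanent over `ℂ`; projections keep product-depth and do not increase wires; `L₃` of a polynomial in
  `m` exceeds `L₃ m` by at most `1` along the tower `m = 2^2^2^Y`) — the proof of
  `perHardLog3_of_slopeRate` with the homogenisation step removed.  With
  `immHardAt_of_homImmHardAt_two_mul` this recovers the g8 reduction `HomImmHardAt 2 1 → PerHardLog3`
  through the inhomogeneous cell, and with duality halving (T2) the cell `ImmHardAt 1 1` IS `Hard(2)`.
* `homImmHardAt_of_le_36_25` — `HomImmHardAt p q` for every `25 p ≤ 36 q` (consumer of lens 2's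
  slope-generic kernel `homBds_slope` / fit `BDS.fit_slope`, file `DepthWindowBDSSlope.lean`): the
  Bhargav–Dutta–Saxena hierarchy in its full rational print range below `1/log₂ φ = 1.4404…`; hence
  `ImmHardAt p q` for `25 p ≤ 18 q`.

[cite: Valiant1979] [cite: LimayeSrinivasanTavenas2025, Lemma 11, Cor. 4]
[cite: BhargavDuttaSaxena2024, Thm. 1.4, Rem. 1.5]
-/

-- layout Summits/ValiantsHypothesis/ValiantsHypothesis forces the duplicated namespace component
set_option linter.dupNamespace false

namespace Summit.ValiantsHypothesis.ValiantsHypothesis.Theorems.DepthWindow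

open MvPolynomial Literature.Computability.AlgebraicComplexity ArithCircuit
open Summit.ValiantsHypothesis.ValiantsHypothesis.Theses.DepthWindow

noncomputable section

/-- `|Fin d × Fin m × Fin m| ≤ m³ + 3` at `d = ⌊√⌊log₂ m⌋⌋`. [folklore] -/
private theorem card_immVars_le_aux (m : ℕ) :
    Fintype.card (Fin (Nat.sqrt (Nat.log 2 m)) × Fin m × Fin m) ≤ m ^ 3 + 3 := by
  simp only [Fintype.card_prod, Fintype.card_fin]
  have hd : Nat.sqrt (Nat.log 2 m) ≤ m := (Nat.sqrt_le_self _).trans (Nat.log_le_self 2 m)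
  calc Nat.sqrt (Nat.log 2 m) * (m * m) ≤ m * (m * m) := Nat.mul_le_mul_right _ hd
    _ = m ^ 3 := by ring
    _ ≤ m ^ 3 + 3 := Nat.le_add_right _ _

/-! ### 2. `ImmHardAt 1 1 → PerHardLog3` (projection transport only) -/

/-- **The `IMM` version of the crux implies the crux** (KERNEL): `IMM_{m,⌊√log₂ m⌋}` is a p-projection
of the permanent (Valiant; VNP-completeness over `ℂ`), projections preserve product-depth and do not
increase the wire count, and `L₃` of a polynomial in `m` exceeds `L₃ m` by at most `1` along the tower
`m = 2^2^2^Y`. [cite: Valiant1979] [cite: LimayeSrinivasanTavenas2025, Cor. 4] -/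
theorem perHardLog3_of_immHardAt_one_one (hI : ImmHardAt 1 1) : PerHardLog3 := by
  classical
  rintro ⟨c, hc⟩
  let dd : ℕ → ℕ := fun m => Nat.sqrt (Nat.log 2 m)
  have hdd_le : ∀ m, dd m ≤ m := fun m => (Nat.sqrt_le_self _).trans (Nat.log_le_self 2 m)
  let v : ℕ → ℕ := fun m => Fintype.card (Fin (dd m) × Fin m × Fin m)
  let e : ∀ m, (Fin (dd m) × Fin m × Fin m) ≃ Fin (v m) := fun m => Fintype.equivFin _
  let G : ∀ m, MvPolynomial (Fin (dd m) × Fin m × Fin m) ℂ := fun m => immPoly m (dd m) ℂ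
  let G' : ∀ m, MvPolynomial (Fin (v m)) ℂ := fun m => renameEquiv ℂ (e m) (G m)
  have hv : ∀ m, Fintype.card (Fin (dd m) × Fin m × Fin m) ≤ m ^ 3 + 3 := card_immVars_le_aux
  have hG : IsVPFamily G := by
    refine ⟨⟨⟨3, fun m => hv m⟩, ⟨1, fun m => ?_⟩⟩, ⟨6, fun m => ?_⟩⟩
    · show (immPoly m (dd m) ℂ).totalDegree ≤ m ^ 1 + 1
      refine ((immPoly_isHomogeneous_holds (k := ℂ) m (dd m)).totalDegree_le).trans ?_
      rw [pow_one]; exact (hdd_le m).trans (Nat.le_succ m)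
    · show complexity (immPoly m (dd m) ℂ) ≤ m ^ 6 + 6
      calc complexity (immPoly m (dd m) ℂ) ≤ m + 2 * m ^ 3 * dd m := complexity_immPoly_le ℂ m (dd m)
        _ ≤ m ^ 1 + 2 * (m ^ 1) ^ 3 * m := by
            rw [pow_one]; exact Nat.add_le_add_left (Nat.mul_le_mul_left _ (hdd_le m)) _
        _ ≤ m ^ (3 * 1 + 3) + (3 * 1 + 3) := imm_cost_le 1 m
        _ = m ^ 6 + 6 := by norm_num
  have hG' : IsVPFamily G' := (isVPFamily_renameEquiv_iff e G).2 hG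
  have hG'N : IsVNPFamily G' := IsVPFamily.isVNPFamily_holds' hG'
  obtain ⟨t, ht, hproj⟩ := (isVNPComplete_perPoly_holds ℂ ringChar_complex_ne_two).2 v G' hG'N
  obtain ⟨b, hb⟩ : IsPBounded fun m => t m ^ c + c :=
    IsPBounded.comp_holds (s := fun N => N ^ c + c) ⟨c, fun N => le_rfl⟩ ht
  obtain ⟨a, ha⟩ := ht
  -- few-gate circuits for `IMM_{m, dd m}` of product-depth `≤ L₃ (t m) + 1`
  have key : ∀ m, ∃ D : ArithCircuit ℂ (Fin (dd m) × Fin m × Fin m),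
      D.Computes (G m) ∧ D.productDepth ≤ Nat.log 2 (Nat.log 2 (Nat.log 2 (t m))) + 1 ∧
        D.size ≤ m ^ b + b := by
    intro m
    obtain ⟨C, hCc, hCd, hCe⟩ := hc (t m)
    obtain ⟨D', hD'c, hD'd, hD'e, -⟩ := exists_circuit_of_isProjection (hproj m) C hCc
    have hGm : MvPolynomial.rename (e m).symm (G' m) = G m := by
      show MvPolynomial.rename (e m).symm (renameEquiv ℂ (e m) (G m)) = G m
      rw [renameEquiv_apply, rename_rename, (e m).symm_comp_self, rename_id_apply]
    obtain ⟨D, hDe, hDd, hDw, hDs⟩ := exists_size_le_edgeSize (D'.rename (e m).symm)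
    refine ⟨D, ?_, ?_, ?_⟩
    · rw [Computes, hDe, ← hGm]; exact hD'c.rename (e m).symm
    · exact hDd.trans ((DepthThreeChasm.productDepth_rename _ _).le.trans (hD'd.trans hCd))
    · calc D.size ≤ D.edgeSize := hDs
        _ ≤ (D'.rename (e m).symm).edgeSize := hDw
        _ = D'.edgeSize := DepthThreeChasm.edgeSize_rename _ _
        _ ≤ C.edgeSize := hD'e
        _ ≤ t m ^ c + c := hCe
        _ ≤ m ^ b + b := hb m
  -- inhomogeneous hardness at slope `1`, exponent `b + 2`, from `m₀` on
  obtain ⟨m₀, hm₀⟩ := hI (b + 2)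
  obtain ⟨Y, hYa, hYm⟩ : ∃ Y : ℕ, a + 1 ≤ 2 ^ Y ∧ m₀ ≤ Y := by
    refine ⟨a + m₀ + 1, ?_, by omega⟩
    have : a + m₀ + 1 < 2 ^ (a + m₀ + 1) := Nat.lt_two_pow_self
    omega
  set m : ℕ := 2 ^ (2 ^ (2 ^ Y)) with hm
  have hYm' : m₀ ≤ m := by
    have h1 : Y < 2 ^ Y := Nat.lt_two_pow_self
    have h2 : 2 ^ Y < 2 ^ (2 ^ Y) := Nat.pow_lt_pow_right (by norm_num) h1
    have h3 : 2 ^ (2 ^ Y) < 2 ^ (2 ^ (2 ^ Y)) := Nat.pow_lt_pow_right (by norm_num) h2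
    omega
  have hm1 : 1 ≤ m := Nat.one_le_two_pow
  have hL3m : Nat.log 2 (Nat.log 2 (Nat.log 2 m)) = Y := log3_tower Y
  have hL3t : Nat.log 2 (Nat.log 2 (Nat.log 2 (t m))) ≤ Y + 1 :=
    log3_le_of_le_tower_pow Y a (t m) hYa (ha m)
  obtain ⟨D, hDc, hDd, hDs⟩ := key m
  have hdepth : D.productDepth ≤ 1 * Nat.log 2 (Nat.log 2 (Nat.log 2 m)) / 1 + (b + 2) := by
    rw [hL3m, one_mul, Nat.div_one]; omega
  have hlt := hm₀ m hYm' D hDc hdepth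
  have hmono : m ^ b + b ≤ m ^ (b + 2) + (b + 2) := Nat.add_le_add (Nat.pow_le_pow_right hm1 (by omega)) (by omega)
  omega

/-- The g8 rate-2 reduction recovered through the inhomogeneous cell:
`HomImmHardAt 2 1 → ImmHardAt 1 1 → PerHardLog3`. [cite: LimayeSrinivasanTavenas2025, Lemma 11] -/
theorem perHardLog3_of_hard_two_via_imm (hHard : HomImmHardAt 2 1) : PerHardLog3 :=
  perHardLog3_of_immHardAt_one_one (immHardAt_of_homImmHardAt_two_mul (p := 1) (q := 1) (by simpa using hHard))

/-! ### 4. Print-range completion of the hard column: every slope `≤ 36/25` -/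

/-- **Hard(σ) for every `σ ≤ 36/25 = 1.44 < 1/log₂ φ`** (KERNEL; consumer of lens 2's slope-generic
kernel `homBds_slope` and fit `BDS.fit_slope`): homogeneous circuits of product-depth
`≤ ⌊p L₃ m / q⌋ + c` for `IMM_{m,⌊√log₂ m⌋}` over `ℂ` have more than `m^c + c` gates for all large `m`,
whenever `25 p ≤ 36 q`. [cite: BhargavDuttaSaxena2024, Thm. 1.4, Rem. 1.5] -/
theorem homImmHardAt_of_le_36_25 (p q : ℕ) (h : 25 * p ≤ 36 * q) : HomImmHardAt p q := by
  rcases Nat.eq_zero_or_pos p with rfl | hp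
  · exact homImmHardAt_of_five_mul_le 0 q (by omega)
  · have hq : 0 < q := by omega
    intro c
    obtain ⟨m₀, hm₀⟩ := homBds_slope p q c hp hq h
    exact ⟨m₀, fun m hm D hh hD hpd => hm₀ m hm rfl rfl D hh hD hpd⟩

/-- The cell `Hard(36/25)` as a closed instance (the last rational century-slope below `1/log₂ φ`).
[cite: BhargavDuttaSaxena2024, Thm. 1.4, Rem. 1.5] -/
theorem homImmHardAt_36_25 : HomImmHardAt 36 25 := homImmHardAt_of_le_36_25 36 25 le_rfl

/-- Inhomogeneous currency: `ImmHardAt p q` for every `25 p ≤ 18 q` (`σ ≤ 0.72`), kernel.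
[cite: BhargavDuttaSaxena2024, Thm. 1.4, Rem. 1.5] [cite: LimayeSrinivasanTavenas2025, Lemma 11] -/
theorem immHardAt_of_le_18_25 (p q : ℕ) (h : 25 * p ≤ 18 * q) : ImmHardAt p q :=
  immHardAt_of_homImmHardAt_two_mul (homImmHardAt_of_le_36_25 (2 * p) q (by omega))

end

end Summit.ValiantsHypothesis.ValiantsHypothesis.Theorems.DepthWindow
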